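import Summits.KontsevichZagierPeriods.KontsevichZagierPeriods.Theorems.FurushoPentagonKernelModuloPeriodConjectureLeafWeightLeFourteen
import Summits.KontsevichZagierPeriods.KontsevichZagierPeriods.Theorems.FurushoPentagonKernelModuloPeriodConjectureLeafOfCheckBlocksG
import Summits.KontsevichZagierPeriods.KontsevichZagierPeriods.Theorems.FurushoPentagonKernelModuloPeriodConjectureEdsBlockWeightFifteenA
import Summits.KontsevichZagierPeriods.KontsevichZagierPeriods.Theorems.FurushoPentagonKernelModuloPeriodConjectureEdsBlockWeightFifteenB
import Summits.KontsevichZagierPeriods.KontsevichZagierPeriods.Theorems.FurushoPentagonKernelModuloPeriodConjectureEdsBlockWeightFifteenC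
import Summits.KontsevichZagierPeriods.KontsevichZagierPeriods.Theorems.FurushoPentagonKernelModuloPeriodConjectureEdsBlockWeightFifteenD
import Summits.KontsevichZagierPeriods.KontsevichZagierPeriods.Theorems.FurushoPentagonKernelModuloPeriodConjectureEdsBlockWeightFifteenE
import Summits.KontsevichZagierPeriods.KontsevichZagierPeriods.Theorems.FurushoPentagonKernelModuloPeriodConjectureEdsBlockWeightFifteenF
import Summits.KontsevichZagierPeriods.KontsevichZagierPeriods.Theorems.FurushoPentagonKernelModuloPeriodConjectureEdsBlockWeightFifteenG
import HarnessLib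

/-!
# `KernelModuloPeriodConjecture`, line `Sketch`: Hoffman spanning for abstract associators, weight ≤ 15

Crux `FurushoPentagon.KernelModuloPeriodConjecture` (stmt-KontsevichZagierPeriods-15058), line
`Sketch`, lead c6. ONE citable theorem extending the weight `≤ 14` assembly of lead c5
(`stub_associatorHoffmanSpanning_of_weight_le_14`) by weight `15`: for EVERY admissible index `s`
of weight `≤ 15` there is one finitely supported `b` on Hoffman indices of the same weight with
`c_{bw s}(φ) = Σ_t b_t c_{bw t}(φ)` at every group-like solution `φ` of Drinfeld's pentagon over
every commutative `ℚ`-algebra — the coordinate form of `GRT₁ ≅ U^{dR}_{MT(ℤ)}` (equivalently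
`𝔤𝔯𝔱₁ = 𝔤^𝔪`) in weights `≤ 15` for abstract associators, here a kernel-checked theorem. Weight
`15` (`2^13 − d₁₅ = 8164` non-Hoffman admissible words) is Ihara–Kaneko–Zagier's linearised
extended double shuffle system reduced mod 2 in SEVEN depth blocks `(0,5]` (1092 columns; the
only block with grouped rows: the plain rows of depth `≤ 5` are rank-deficient by `64` mod 2 — the
cusp defect of the depth filtration — and 64 short XOR-groups of plain rows with cancelling
depth-6/7 parts close it), `(5,6]` (1267), `(6,7]` (1709), `(7,8]` (1716), `(8,9]` (1287),
`(9,10]` (715), `(10,14]` (378), each ONE kernel run (`decide +kernel`, 30–120 s on the gate),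
assembled by the grouped block master `leaf_of_checkBlocks_mixed`. For comparison, the printed
verifications of IKZ's Conjecture 1 are numerical (IKZ, weight ≤ 16 or so) or ranks of the EDS
matrix of REAL multiple zeta values modulo a prime (Kaneko–Noro–Tsurumaki 2008, weight ≤ 20).

References: K. Ihara, M. Kaneko, D. Zagier, Compos. Math. 142 (2006) §2, Conjecture 1
[IharaKanekoZagier2006]; M. Kaneko, M. Noro, K. Tsurumaki, IMA Vol. Math. Appl. 148 (2008)
47–58; H. Furusho, Ann. of Math. 174 (2011) Thm 1.2 [Furusho2011]; F. Brown, Ann. of Math. 175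
(2012) Thm 1.1 [Brown2012]; V. Drinfeld, Leningrad Math. J. 2 (1991).
-/

namespace Summit.KontsevichZagierPeriods.FurushoPentagon.KernelModuloPeriodConjecture

open Literature.NumberTheory.Transcendental

/-- Every column of weight `15` has depth at most `14` (closing the chain of the seven blocks). A
kernel computation. [folklore] -/
theorem depthCovered_15 : LinEDS.depthCovered 15 14 = true := by
  decide +kernel

/-- **The weight-15 slice of the algebraic leaf**: Hoffman spanning for every admissible index of
weight `15` at every group-like pentagon solution, from the seven depth-block certificates
(`stub_edsBlockG_15_0_5` grouped, `stub_edsBlock_15_5_6`, …, `stub_edsBlock_15_10_14` plain) by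
the mixed block master. [cite: IharaKanekoZagier2006, Conjecture 1] -/
theorem leafWeightFifteen (s : List ℕ) (hs : MZV.IsAdmissible s) (hw : MZV.weight s = 15) :
    ∃ b : List ℕ →₀ ℚ, (∀ t ∈ b.support, MZV.IsHoffman t ∧ MZV.weight t = MZV.weight s) ∧ ∀ (R : Type) [CommRing R] [Algebra ℚ R] [IsReduced R] (φ : NCSeries Bool R), NCSeries.IsGroupLike φ → NCSeries.DrinfeldPentagon φ → φ (MZV.binaryWord s) = b.sum (fun t q => q • φ (MZV.binaryWord t)) := by
  refine leaf_of_checkBlocks_mixed 15 [(0, 5), (5, 6), (6, 7), (7, 8), (8, 9), (9, 10), (10, 14)]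
    (by norm_num) (List.cons_ne_nil _ _) (by decide) rfl (by decide) (fun p hp => ?_)
    (show LinEDS.depthCovered 15 14 = true from depthCovered_15) s hs hw
  simp only [List.mem_cons, List.not_mem_nil, or_false] at hp
  rcases hp with rfl | rfl | rfl | rfl | rfl | rfl | rfl
  · exact Or.inr stub_edsBlockG_15_0_5
  · exact Or.inl stub_edsBlock_15_5_6
  · exact Or.inl stub_edsBlock_15_6_7
  · exact Or.inl stub_edsBlock_15_7_8
  · exact Or.inl stub_edsBlock_15_8_9
  · exact Or.inl stub_edsBlock_15_9_10
  · exact Or.inl stub_edsBlock_15_10_14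

/-- **Registered stub `stub_associatorHoffmanSpanning_of_weight_le_15`** (lead c6; crux
stmt-KontsevichZagierPeriods-15058, line `Sketch`): the algebraic leaf `AssociatorHoffmanSpanning`
for every admissible index of weight at most `15` — weight `≤ 14` is the tree theorem
`stub_associatorHoffmanSpanning_of_weight_le_14`, weight `15` is `leafWeightFifteen`.
[cite: IharaKanekoZagier2006, Conjecture 1] -/
theorem stub_associatorHoffmanSpanning_of_weight_le_15 :
    ∀ s : List ℕ, MZV.IsAdmissible s → MZV.weight s ≤ 15 →
      ∃ b : List ℕ →₀ ℚ, (∀ t ∈ b.support, MZV.IsHoffman t ∧ MZV.weight t = MZV.weight s) ∧ ∀ (R : Type) [CommRing R] [Algebra ℚ R] [IsReduced R] (φ : NCSeries Bool R), NCSeries.IsGroupLike φ → NCSeries.DrinfeldPentagon φ → φ (MZV.binaryWord s) = b.sum (fun t q => q • φ (MZV.binaryWord t)) := by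
  intro s hs h15
  by_cases h14 : MZV.weight s ≤ 14
  · exact stub_associatorHoffmanSpanning_of_weight_le_14 s hs h14
  · exact leafWeightFifteen s hs (by omega)

end Summit.KontsevichZagierPeriods.FurushoPentagon.KernelModuloPeriodConjecture
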